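/-
Origin: expansion seat `prover-pub-hodgecm-mc-sinst-1-g7-0`, handover #1232 2026-08-20T16:05Z md5 af5b91b5f93f (72 l., 4 theorems) NEW additive leaf, ns HodgeCM.Model.SInstance.GRU; imports RUN-55 #1230 ThetaAdelicSideR2U only (ROWDEP: after #1230 lands); drop-alone; the empty-index members of the GRU schema as theorems; NAME LIST: HodgeCM.Model.SInstance.GRU.compatibleSplitting_of_subsingleton · HodgeCM.Model.SInstance.GRU.inst_zero_left · HodgeCM.Model.SInstance.GRU.inst_zero_right (`HOME/mc/pub-hodgecm-mc-sinst-1-g7/stage/HodgeCM/Model/ThetaAdelicSideR2UDegenerate.lean`, md5 af5b91b5f93f, 72 lines);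
landed by the second packager p2 gen 10 (p2-g10) in gate run 56 as `HodgeCM/Model/ThetaAdelicSideR2UDegenerate.lean` (verbatim).
-/
/-
Origin: CONSTRUCTION seat `prover-pub-hodgecm-mc-sinst-1-g7-0` (unit pub-hodgecm-mc-sinst-1-g7, gen 7 of mc-sinst-1 — S-INSTANCE CONSTRUCTOR,
BINDER-OWNERS row 5 `S`), 2026-08-20.  KERNEL only: theorems; closure {propext, Classical.choice, Quot.sound}.  Additive leaf over #1230
`ThetaAdelicSideR2U`; nothing of PerL ∕ QW8 is claimed; 0 records, 0 `def … : Prop`, nothing cited.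
-/
import Summits.HodgeConjecture.HodgeCM.Model.ThetaAdelicSideR2U

/-!
# (GR-U-∅) the EMPTY-INDEX members of the uniform [GR91 3.1.1] schema hold OUTRIGHT

The schema `SInstance.GRU` (#1230) quantifies [GelbartRogawski1991, Prop. 3.1.1] over every constructed CM dual-pair datum
`cmSplittingDatum L e dV … dW …`, including the members with `N = 0` or `M = 0`, which print (stated for an `n`-dimensional
skew-Hermitian space, `n ≥ 1`) does not literally address.  They need no citation: the big unitary group
`G₁ = U(diag dV ⊗ diag dW)(𝔸) ≤ GL_{Fin N × Fin M}(𝔸_L)` is TRIVIAL when the index type is empty, and the trivial homomorphism is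
a continuous compatible splitting of any `SplittingDatum` with trivial `G(𝐀)`.

* `SInstance.GRU.compatibleSplitting_of_subsingleton` — abstract: `Subsingleton GA → D.CompatibleSplitting` (`s := 1`);
* `SInstance.GRU.inst_zero_left` ∕ `inst_zero_right` — the `N = 0` ∕ `M = 0` members of the schema, as theorems with no hypothesis.

So the citation scope of `hGRU` beyond the five families of record is exactly print's own: all `N, M ≥ 1` (an `N·M`-dimensional
non-degenerate skew-hermitian space over `E = L`, `F = L⁺`, pp. 449 ∕ 454–455), the remaining members being theorems of this file.
-/


set_option autoImplicit false

noncomputable section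

open NumberField
open Literature.NumberTheory.Automorphic Literature.NumberTheory.Weil1964
open Literature.NumberTheory.GelbartRogawski1991 Literature.NumberTheory.GelbartRogawski1991.UnitaryDualPair

namespace HodgeCM.Model.SInstance.GRU

universe u v w

/-- **an abstract splitting datum whose `G(𝐀)` is trivial has a continuous compatible splitting**: `s := 1`
(`π(1) = 1 = ι(g)` since `g = 1`; `1 ∈ i(Sp_F(W))`). -/
theorem compatibleSplitting_of_subsingleton {Sp : Type u} {Mp : Type v} {GA : Type w} [Group Sp] [Group Mp] [Group GA]
    [TopologicalSpace GA] [TopologicalSpace Mp] [Subsingleton GA] (D : SplittingDatum Sp Mp GA) :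
    D.CompatibleSplitting := by
  refine ⟨1, ?_, ?_, ?_⟩
  · exact continuous_const
  · intro g
    rw [Subsingleton.elim g 1, map_one, map_one, map_one]
  · intro γ _
    exact ⟨1, by rw [map_one, MonoidHom.one_apply]⟩

/-- `GL` over an EMPTY index type is trivial (the matrix ring is). -/
theorem subsingleton_GL_of_isEmpty (ι : Type u) (R : Type v) [Fintype ι] [DecidableEq ι] [IsEmpty ι] [CommRing R] :
    Subsingleton (GL ι R) :=
  ⟨fun _ _ => Units.ext (Subsingleton.elim _ _)⟩

/-- **the `N = 0` members of the schema hold outright** (no citation needed: `G₁(𝔸)` is trivial). -/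
theorem inst_zero_left (L : Type) [Field L] [NumberField L] [NumberField.IsCMField L] {M n : ℕ} (e : Fin 0 × Fin M ≃ Fin n)
    (dV : Fin 0 → L) (hdV : ∀ i, NumberField.IsCMField.complexConj L (dV i) = dV i) (hdV0 : ∀ i, dV i ≠ 0)
    (dW : Fin M → L) (hdW : ∀ i, NumberField.IsCMField.complexConj L (dW i) = dW i) (hdW0 : ∀ i, dW i ≠ 0) :
    (cmSplittingDatum L e dV hdV hdV0 dW hdW hdW0).CompatibleSplitting :=
  haveI := subsingleton_GL_of_isEmpty (Fin 0 × Fin M) (AdeleRing (𝓞 L) L)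
  compatibleSplitting_of_subsingleton _

/-- **the `M = 0` members of the schema hold outright** (no citation needed: `G₁(𝔸)` is trivial). -/
theorem inst_zero_right (L : Type) [Field L] [NumberField L] [NumberField.IsCMField L] {N n : ℕ} (e : Fin N × Fin 0 ≃ Fin n)
    (dV : Fin N → L) (hdV : ∀ i, NumberField.IsCMField.complexConj L (dV i) = dV i) (hdV0 : ∀ i, dV i ≠ 0)
    (dW : Fin 0 → L) (hdW : ∀ i, NumberField.IsCMField.complexConj L (dW i) = dW i) (hdW0 : ∀ i, dW i ≠ 0) :
    (cmSplittingDatum L e dV hdV hdV0 dW hdW hdW0).CompatibleSplitting :=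
  haveI := subsingleton_GL_of_isEmpty (Fin N × Fin 0) (AdeleRing (𝓞 L) L)
  compatibleSplitting_of_subsingleton _

end HodgeCM.Model.SInstance.GRU

end
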